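import Summits.AnomalousDissipation.AnomalousDissipation.Theorems.SawtoothPulseCascadeK1LocalisedCascadeFibreChirp
import Summits.AnomalousDissipation.AnomalousDissipation.Theorems.SawtoothPulseCascadeK1LocalisedCascadeIterateGradient
import Mathlib.Analysis.SpecialFunctions.Complex.Log

/-!
# K1loc, line `Spectral` / thin start — helper: THE COMB SELECTION RULE (a `1/N`-periodic shear moves frequencies by multiples of `N`)

Helper file of the prover lane on the crux `K1LocalisedCascade` (stmt-AnomalousDissipation-19491), route
`SawtoothPulseCascade` (S-B/S-C assembly seat; Fourier bookkeeping).  The shear profile of phase `j` of the cascade,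
`U_j(y) = S_{δ_j}(2πN_j y)/(2πN_j)`, has period `1/N_j` (`U_add_inv_N`), hence so has every chirp `e_{−m} ∘ (γU_j)` of the fibre
reduction (`…FibreChirp`).  A continuous function on the circle with period `1/N` has Fourier coefficients supported on `Nℤ`
(`fourierCoeff_eq_zero_of_periodic`: substitute `z ↦ z + 1/N` in the coefficient integral; `e^{−2πim/N} ≠ 1` unless `N ∣ m`).
Consequence — the COMB SELECTION RULE of the tree's fibre formula (`Torus.mFourierCoeff_comp_shearMap`: `𝓕(θ ∘ Φ)(k) =
Σ_m ĝ_{kᵢ}(m)·𝓕θ(k − m eⱼ)`): for a `1/N`-periodic profile only the terms `m ∈ Nℤ` survive, **`𝓕(θ ∘ Φ)(k) = Σ_ℓ ĝ_{kᵢ}(Nℓ)·𝓕θ(k − Nℓ eⱼ)`**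
(`mFourierCoeff_comp_shearMap_comb`) — a half-pulse of phase `j` changes the transverse frequency `k_j` only by multiples of `N_j`
(`fourierCoeff_twist_cascade_eq_zero`, `mFourierCoeff_hstep_comb`, `mFourierCoeff_vstep_comb`).  This is the exact sparsity used by
the certified profile of the crux idea `averaged-comb-ledger` (its comb kernels) and by any sharp fibre ledger.  No definitions; no estimate.
[cite: Grafakos2014, Prop. 3.1.2 (5) (coefficients of translates)] [problem: turb]
-/

-- `Summit.<Summit>.<Problem>`: single-conjunct summit, the duplicate namespace segment is deliberate.
set_option linter.dupNamespace false

noncomputable section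

namespace Summit.AnomalousDissipation.AnomalousDissipation.Theorems.SawtoothPulseCascade.K1Start

open MeasureTheory Set Filter Topology UnitAddTorus Function Complex
open Literature.Analysis Literature.Analysis.FunctionSpaces Literature.Analysis.FunctionSpaces.Torus Literature.Analysis.FluidPDE
open Literature.Analysis.FluidPDE.ShearStage
open Literature.Analysis.FluidPDE.SawtoothCascade Literature.Analysis.FluidPDE.SawtoothCascade.CascadeParams

/-! ## §1 `1/N`-periodic functions on the circle have Fourier support in `Nℤ` -/

/-- `e_{−m}(1/N) = 1` forces `N ∣ m` (`N ≥ 1`). [folklore] -/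
theorem int_dvd_of_fourier_inv_nat_eq_one {N : ℕ} (hN : 0 < N) {m : ℤ}
    (h : (fourier (-m) (((1 / (N : ℝ) : ℝ)) : UnitAddCircle) : ℂ) = 1) : (N : ℤ) ∣ m := by
  rw [fourier_coe_apply] at h
  obtain ⟨n, hn⟩ := Complex.exp_eq_one_iff.1 h
  have hN0 : (N : ℂ) ≠ 0 := by exact_mod_cast hN.ne'
  have h2 : (2 * Real.pi * I : ℂ) ≠ 0 := by
    simp [Real.pi_ne_zero, Complex.I_ne_zero]
  -- `2πi(−m)(1/N)/1 = n·2πi` ⇒ `−m = nN`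
  have key : (2 * (Real.pi : ℂ) * I) * (-(m : ℂ) / (N : ℂ)) = (2 * (Real.pi : ℂ) * I) * (n : ℂ) := by
    have e1 : (2 * (Real.pi : ℂ) * I) * (-(m : ℂ) / (N : ℂ)) =
        2 * (Real.pi : ℂ) * I * ((-m : ℤ) : ℂ) * (((1 / (N : ℝ) : ℝ)) : ℂ) / ((1 : ℝ) : ℂ) := by
      push_cast; ring
    rw [e1, hn]; ring
  have h3 : -(m : ℂ) / (N : ℂ) = n := mul_left_cancel₀ h2 key
  have hmn : -(m : ℂ) = n * N := by rwa [div_eq_iff hN0] at h3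
  refine ⟨-n, ?_⟩
  have : ((m : ℤ) : ℂ) = ((N * -n : ℤ) : ℂ) := by push_cast; linear_combination -hmn
  exact_mod_cast this

/-- **A `1/N`-periodic function on the circle has Fourier coefficients supported on `Nℤ`**: if `G(z + 1/N) = G(z)` for all `z`
and `N ∤ m` then `Ĝ(m) = 0` (translate the coefficient integral by `1/N`). [cite: Grafakos2014, Prop. 3.1.2 (5)] -/
theorem fourierCoeff_eq_zero_of_periodic {G : UnitAddCircle → ℂ} {N : ℕ} (hN : 0 < N)
    (hG : ∀ z : UnitAddCircle, G (z + (((1 / (N : ℝ) : ℝ)) : UnitAddCircle)) = G z) {m : ℤ} (hm : ¬ (N : ℤ) ∣ m) :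
    fourierCoeff G m = 0 := by
  set c : UnitAddCircle := (((1 / (N : ℝ) : ℝ)) : UnitAddCircle) with hc
  have h1 : fourierCoeff G m = (fourier (-m) c : ℂ) * fourierCoeff G m := by
    calc fourierCoeff G m = ∫ t, fourier (-m) (t + c) • G (t + c) ∂AddCircle.haarAddCircle := by
          unfold fourierCoeff
          exact (integral_add_right_eq_self (μ := AddCircle.haarAddCircle) (fun t => fourier (-m) t • G t) c).symm
      _ = (fourier (-m) c : ℂ) * fourierCoeff G m := by
          unfold fourierCoeff
          simp_rw [fourier_apply_add (-m) _ c, hG, mul_smul, integral_smul, smul_eq_mul]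
  have hne : (fourier (-m) c : ℂ) ≠ 1 := fun h => hm (int_dvd_of_fourier_inv_nat_eq_one hN h)
  have h2 : (1 - (fourier (-m) c : ℂ)) * fourierCoeff G m = 0 := by rw [sub_mul, one_mul, ← h1, sub_self]
  rcases mul_eq_zero.1 h2 with h3 | h3
  · exact absurd (sub_eq_zero.1 h3).symm hne
  · exact h3

/-- **A `1/N`-periodic profile has `1/N`-periodic chirps**: `twist φ m (z + 1/N) = twist φ m z` if `φ(t + 1/N) = φ(t)`. [folklore] -/
theorem twist_add_inv_nat {φ : ShearProfile} {N : ℕ} (hφ : ∀ t : ℝ, φ (t + 1 / (N : ℝ)) = φ t) (m : ℤ) (z : UnitAddCircle) :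
    twist φ m (z + (((1 / (N : ℝ) : ℝ)) : UnitAddCircle)) = twist φ m z := by
  induction z using QuotientAddGroup.induction_on with
  | H t =>
    rw [twist_apply, twist_apply, ← AddCircle.coe_add, ShearProfile.onCircle_coe, ShearProfile.onCircle_coe, hφ]

/-- Hence **the chirp coefficients of a `1/N`-periodic profile live on `Nℤ`**: `𝓕(twist φ n)(m) = 0` unless `N ∣ m`.
[cite: Grafakos2014, Prop. 3.1.2 (5)] -/
theorem fourierCoeff_twist_eq_zero_of_periodic {φ : ShearProfile} {N : ℕ} (hN : 0 < N)
    (hφ : ∀ t : ℝ, φ (t + 1 / (N : ℝ)) = φ t) (n : ℤ) {m : ℤ} (hm : ¬ (N : ℤ) ∣ m) :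
    fourierCoeff (twist φ n) m = 0 :=
  fourierCoeff_eq_zero_of_periodic hN (twist_add_inv_nat hφ n) hm

/-! ## §2 The comb selection rule for the shear Koopman operator -/

variable {d : Type*} [Fintype d] [DecidableEq d]

/-- **Comb selection rule.**  For smooth `θ : 𝕋^d → ℂ`, `i ≠ j` and a `1/N`-periodic profile `φ` (`N ≥ 1`), the fibre formula
keeps only the comb `m ∈ Nℤ`: `𝓕(θ ∘ Φ)(k) = Σ' ℓ, 𝓕(twist φ (kᵢ))(Nℓ)·𝓕θ(k − Nℓ·eⱼ)` — the shear changes the transverse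
frequency `k_j` only by multiples of `N`. [cite: Grafakos2014, Prop. 3.1.2 (5)] -/
theorem mFourierCoeff_comp_shearMap_comb {θ : UnitAddTorus d → ℂ} (hθ : IsSmooth θ) {i j : d} (hij : i ≠ j)
    {φ : ShearProfile} {N : ℕ} (hN : 0 < N) (hφ : ∀ t : ℝ, φ (t + 1 / (N : ℝ)) = φ t) (k : d → ℤ) :
    mFourierCoeff (θ ∘ shearMap i j φ) k =
      ∑' ℓ : ℤ, fourierCoeff (twist φ (k i)) (N * ℓ) * mFourierCoeff θ (k - Pi.single j ((N : ℤ) * ℓ)) := by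
  have hsum : Summable fun k => ‖mFourierCoeff θ k‖ := hθ.rapidDecay_mFourierCoeff.summable.norm
  rw [Torus.mFourierCoeff_comp_shearMap hθ.continuous hsum hij φ k]
  -- the terms off the comb vanish
  set f : ℤ → ℂ := fun m => fourierCoeff (twist φ (k i)) m * mFourierCoeff θ (k - Pi.single j m) with hf
  have hinj : Function.Injective fun ℓ : ℤ => (N : ℤ) * ℓ :=
    fun a b h => mul_left_cancel₀ (by exact_mod_cast hN.ne') h
  have hsupp : Function.support f ⊆ Set.range fun ℓ : ℤ => (N : ℤ) * ℓ := by
    intro m hm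
    rw [Function.mem_support] at hm
    by_contra hrange
    have hdvd : ¬ (N : ℤ) ∣ m := fun ⟨ℓ, hℓ⟩ => hrange ⟨ℓ, hℓ.symm⟩
    exact hm (by rw [hf]; simp only [fourierCoeff_twist_eq_zero_of_periodic hN hφ (k i) hdvd, zero_mul])
  exact (hinj.tsum_eq hsupp).symm

/-! ## §3 The cascade: phase `j` has period `1/N_j` -/

section Cascade

variable (P : CascadeParams)

/-- **The shear profile of phase `j` has period `1/N_j`**: `U_j(y + 1/N_j) = U_j(y)` (`S_δ` is `2π`-periodic).
[cite: ElgindiLissMattingly2025, §1 (H_α, V_α)] -/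
theorem U_add_inv_N (hN₀ : 1 ≤ P.N₀) (hρ : 1 ≤ P.ρN) (j : ℕ) (y : ℝ) : P.U j (y + 1 / (P.N j : ℝ)) = P.U j y := by
  have hN : (0 : ℝ) < P.N j := by exact_mod_cast P.N_pos hN₀ hρ j
  unfold CascadeParams.U
  congr 1
  rw [mul_add, show 2 * Real.pi * (P.N j : ℝ) * (1 / (P.N j : ℝ)) = 2 * Real.pi by field_simp]
  exact roundedSaw_periodic (P.δ j) _

/-- The amplified profile `γ•U_j` (as a `ShearProfile`) has period `1/N_j`. [folklore] -/
theorem amp_U_add_inv_N (hN₀ : 1 ≤ P.N₀) (hρ : 1 ≤ P.ρN) {j : ℕ} (hδ : 0 < P.δ j) (γ t : ℝ) :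
    amp ⟨P.U j, P.U_periodic j, P.contDiff_U hδ⟩ γ (t + 1 / (P.N j : ℝ)) = amp ⟨P.U j, P.U_periodic j, P.contDiff_U hδ⟩ γ t := by
  rw [amp_apply, amp_apply]
  show γ * P.U j (t + 1 / (P.N j : ℝ)) = γ * P.U j t
  rw [U_add_inv_N P hN₀ hρ j t]

/-- **The chirps of phase `j` live on the comb `N_jℤ`**: `𝓕(twist (γ•U_j) n)(m) = 0` unless `N_j ∣ m`.
[cite: Grafakos2014, Prop. 3.1.2 (5)] -/
theorem fourierCoeff_twist_cascade_eq_zero (hN₀ : 1 ≤ P.N₀) (hρ : 1 ≤ P.ρN) {j : ℕ} (hδ : 0 < P.δ j) (γ : ℝ) (n : ℤ)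
    {m : ℤ} (hm : ¬ (P.N j : ℤ) ∣ m) :
    fourierCoeff (twist (amp ⟨P.U j, P.U_periodic j, P.contDiff_U hδ⟩ γ) n) m = 0 :=
  fourierCoeff_twist_eq_zero_of_periodic (P.N_pos hN₀ hρ j) (fun t => amp_U_add_inv_N P hN₀ hρ hδ γ t) n hm

/-- **H half-step of phase `j`: the vertical frequency changes only by multiples of `N_j`.**  For smooth `a` and
`b = a ∘ shearMap 0 1 (γ•U_j)`:  `𝓕b(k) = Σ' ℓ, 𝓕(twist (γ•U_j) (k₀))(N_jℓ)·𝓕a(k − N_jℓ·e₁)`. [cite: Grafakos2014, Prop. 3.1.2 (5)] -/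
theorem mFourierCoeff_hstep_comb (hN₀ : 1 ≤ P.N₀) (hρ : 1 ≤ P.ρN) {j : ℕ} (hδ : 0 < P.δ j) (γ : ℝ)
    {a : UnitAddTorus (Fin 2) → ℂ} (ha : IsSmooth a) (k : Fin 2 → ℤ) :
    mFourierCoeff (a ∘ shearMap 0 1 (amp ⟨P.U j, P.U_periodic j, P.contDiff_U hδ⟩ γ)) k =
      ∑' ℓ : ℤ, fourierCoeff (twist (amp ⟨P.U j, P.U_periodic j, P.contDiff_U hδ⟩ γ) (k 0)) (P.N j * ℓ) *
        mFourierCoeff a (k - Pi.single 1 ((P.N j : ℤ) * ℓ)) :=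
  mFourierCoeff_comp_shearMap_comb ha (by decide) (P.N_pos hN₀ hρ j) (fun t => amp_U_add_inv_N P hN₀ hρ hδ γ t) k

/-- **V half-step of phase `j`: the horizontal frequency changes only by multiples of `N_j`.**  For smooth `b` and
`a' = b ∘ shearMap 1 0 (γ•U_j)`:  `𝓕a'(k) = Σ' ℓ, 𝓕(twist (γ•U_j) (k₁))(N_jℓ)·𝓕b(k − N_jℓ·e₀)`. [cite: Grafakos2014, Prop. 3.1.2 (5)] -/
theorem mFourierCoeff_vstep_comb (hN₀ : 1 ≤ P.N₀) (hρ : 1 ≤ P.ρN) {j : ℕ} (hδ : 0 < P.δ j) (γ : ℝ)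
    {b : UnitAddTorus (Fin 2) → ℂ} (hb : IsSmooth b) (k : Fin 2 → ℤ) :
    mFourierCoeff (b ∘ shearMap 1 0 (amp ⟨P.U j, P.U_periodic j, P.contDiff_U hδ⟩ γ)) k =
      ∑' ℓ : ℤ, fourierCoeff (twist (amp ⟨P.U j, P.U_periodic j, P.contDiff_U hδ⟩ γ) (k 1)) (P.N j * ℓ) *
        mFourierCoeff b (k - Pi.single 0 ((P.N j : ℤ) * ℓ)) :=
  mFourierCoeff_comp_shearMap_comb hb (by decide) (P.N_pos hN₀ hρ j) (fun t => amp_U_add_inv_N P hN₀ hρ hδ γ t) k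

end Cascade

end Summit.AnomalousDissipation.AnomalousDissipation.Theorems.SawtoothPulseCascade.K1Start
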